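import Summits.AnomalousDissipation.AnomalousDissipation.Theorems.MomentParityResolvedDissipationStubSmoothCylRow

/-!
# `MomentParity.ResolvedDissipation` (stmt-AnomalousDissipation-14284), line `enstrophy-ui-transfer`:
# the LEVEL LEDGER — energy flux through enstrophy levels (instance `Ψ(e,z) = ½ e h(z)` of the smooth cylindrical row)

Supports stmt-AnomalousDissipation-14284 (helper of the line lead; nothing here closes an item). Instance of the LANDED
smooth cylindrical row `CylRow.stub_smoothCylRow` (`Theorems/MomentParityResolvedDissipationStubSmoothCylRow.lean`).

For an admissible law `μ` at `(ν, f, N, R)` and every `h ∈ C¹` near `[0,∞)`: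
`∫ [ h(Z_N u) ⟨F(u), P_N u⟩ + ‖u‖² h'(Z_N u) ⟨F(u), A P_N u⟩ ] dμ = 0`,
i.e. (on level-`N` fields `⟨F(u), P_N u⟩ = (f,u) − ν‖∇u‖²`) the LEVEL LEDGER of attack U2:
`ν E[Z h(Z)] = E[(f,u) h(Z)] + E[‖u‖² h'(Z) Ż/2]`, `Ż/2 = ⟨F(u), A u⟩ = (f, Au) − ν|Au|² − b(u,u,Au)`:
the enstrophy held above a level is paid for by the injection above the level plus the ENERGY FLUX carried across
the level by enstrophy-raising (vortex-stretching) events. With `h ↑ 1_{(M,∞)}` this is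
`ν E[Z; Z>M] ≈ E[(f,u); Z>M] + (flux through {Z = M})`; the first term is `≤ ‖f‖R·G/M` uniformly (Chebyshev), so the
hard stub U (uniform integrability) is EQUIVALENT to uniform decay of the flux term — the quantity the disprover's
burst family makes large (`R²M E[Z;Z>M]/ν³` by the worst-case stretching bound, one power of `M` too many).
-/

noncomputable section

-- `Summit.<Summit>.<Problem>`: single-conjunct summit, the duplicate namespace segment is mandated.
set_option linter.dupNamespace false

namespace Summit.AnomalousDissipation.AnomalousDissipation.Theorems.MomentParityResolvedDissipation

open MeasureTheory Filter Topology
open scoped ENNReal InnerProductSpace RealInnerProductSpace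
open Literature.Analysis.FunctionSpaces Literature.Analysis.FluidPDE
open Summit.AnomalousDissipation.AnomalousDissipation.Theses.MomentParity
open Summit.AnomalousDissipation.AnomalousDissipation.Theorems.CubicParityLoud.Negative (T3 R3 H3 L2T3)
open Summit.AnomalousDissipation.AnomalousDissipation.Theorems.QuarticGate.Negative
  (IsLevel IsBandTest polyGrad IsPolyStationary)

/-- The partial derivatives of the ledger profile `Ψ(e,z) = ½ e h(z)` at a point where `h` is differentiable:
`∂₁Ψ = ½ h(z)`, `∂₂Ψ = ½ e h'(z)`. [folklore] -/
theorem fderiv_ledgerProfile {h : ℝ → ℝ} {e z : ℝ} (hh : DifferentiableAt ℝ h z) :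
    fderiv ℝ (fun p : ℝ × ℝ => 2⁻¹ * p.1 * h p.2) (e, z) (1, 0) = 2⁻¹ * h z ∧
    fderiv ℝ (fun p : ℝ × ℝ => 2⁻¹ * p.1 * h p.2) (e, z) (0, 1) = 2⁻¹ * e * deriv h z := by
  have h1 : HasFDerivAt (fun p : ℝ × ℝ => 2⁻¹ * p.1) ((2⁻¹ : ℝ) • ContinuousLinearMap.fst ℝ ℝ ℝ) (e, z) := by
    simpa using (hasFDerivAt_fst (p := (e, z))).const_mul (2⁻¹ : ℝ)
  have h2 : HasFDerivAt (fun p : ℝ × ℝ => h p.2)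
      ((ContinuousLinearMap.smulRight (1 : ℝ →L[ℝ] ℝ) (deriv h z)).comp (ContinuousLinearMap.snd ℝ ℝ ℝ))
      (e, z) :=
    hh.hasDerivAt.hasFDerivAt.comp (e, z) hasFDerivAt_snd
  have h3 : HasFDerivAt (fun p : ℝ × ℝ => 2⁻¹ * p.1 * h p.2)
      ((2⁻¹ * (e, z).1) • ((ContinuousLinearMap.smulRight (1 : ℝ →L[ℝ] ℝ) (deriv h z)).comp
          (ContinuousLinearMap.snd ℝ ℝ ℝ)) +
        h (e, z).2 • ((2⁻¹ : ℝ) • ContinuousLinearMap.fst ℝ ℝ ℝ)) (e, z) := h1.mul h2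
  rw [h3.fderiv]
  refine ⟨?_, ?_⟩
  · simp [mul_comm]
  · simp

/-- **The level ledger** (instance `Ψ(e,z) = ½ e h(z)` of the smooth cylindrical row of admissible laws). Given the
smooth cylindrical row `hRow` (registered stub `stub_smoothCylRow` of line `enstrophy-ui-transfer`, stated verbatim),
every admissible law `μ` at `(ν, f, N, R)` and every `h : ℝ → ℝ` that is `C¹` on an open set containing `[0,∞)` satisfy
`∫ [ h(Z_N u) ⟨F(u), P_N u⟩ + ‖u‖² h'(Z_N u) ⟨F(u), A P_N u⟩ ] dμ = 0` (integrable row, zero mean), where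
`Z_N u = 4π²Σ_{|k|≤N}|k|²‖û(k)‖²`, `P_N u = fourierTruncate N u`, `A P_N u = realTrigPoly (freqBall N) (4π²|k|² û(k))`.
[folklore; FMRT2001 Ch. IV §1.2] -/
theorem levelLedger_of_smoothCylRow
    (hRow : ∀ (ν : ℝ) (f : T3 → R3), Torus.IsSmooth f →
      ∀ (N : ℕ) (R : ℝ) (μ : Measure H3), IsProbabilityMeasure μ →
        (∀ᵐ u ∂μ, IsLevel N u) → (∀ᵐ u ∂μ, ‖u‖ ≤ R) → (∀ d : ℕ, IsPolyStationary ν f N d μ) →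
      ∀ (U : Set (ℝ × ℝ)) (Ψ : ℝ × ℝ → ℝ), IsOpen U → Set.Ici (0 : ℝ) ×ˢ Set.Ici (0 : ℝ) ⊆ U →
        ContDiffOn ℝ 1 Ψ U →
        Integrable (fun u : H3 =>
          2 * fderiv ℝ Ψ (‖u‖ ^ 2, 4 * Real.pi ^ 2 * ∑ k ∈ Torus.freqBall N, Torus.freqNormSq k *
                ‖UnitAddTorus.mFourierCoeff (EuclideanSpace.complexify ∘ (u.1 : T3 → R3)) k‖ ^ 2) (1, 0) *
              Torus.nsGeneratorPairing ν f u (Torus.fourierTruncate N (u.1 : T3 → R3)) +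
            2 * fderiv ℝ Ψ (‖u‖ ^ 2, 4 * Real.pi ^ 2 * ∑ k ∈ Torus.freqBall N, Torus.freqNormSq k *
                ‖UnitAddTorus.mFourierCoeff (EuclideanSpace.complexify ∘ (u.1 : T3 → R3)) k‖ ^ 2) (0, 1) *
              Torus.nsGeneratorPairing ν f u (Torus.realTrigPoly (Torus.freqBall N) fun k =>
                (((4 * Real.pi ^ 2 * Torus.freqNormSq k : ℝ)) : ℂ) •
                  UnitAddTorus.mFourierCoeff (EuclideanSpace.complexify ∘ (u.1 : T3 → R3)) k)) μ ∧
        ∫ u, (2 * fderiv ℝ Ψ (‖u‖ ^ 2, 4 * Real.pi ^ 2 * ∑ k ∈ Torus.freqBall N, Torus.freqNormSq k *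
                ‖UnitAddTorus.mFourierCoeff (EuclideanSpace.complexify ∘ (u.1 : T3 → R3)) k‖ ^ 2) (1, 0) *
              Torus.nsGeneratorPairing ν f u (Torus.fourierTruncate N (u.1 : T3 → R3)) +
            2 * fderiv ℝ Ψ (‖u‖ ^ 2, 4 * Real.pi ^ 2 * ∑ k ∈ Torus.freqBall N, Torus.freqNormSq k *
                ‖UnitAddTorus.mFourierCoeff (EuclideanSpace.complexify ∘ (u.1 : T3 → R3)) k‖ ^ 2) (0, 1) *
              Torus.nsGeneratorPairing ν f u (Torus.realTrigPoly (Torus.freqBall N) fun k =>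
                (((4 * Real.pi ^ 2 * Torus.freqNormSq k : ℝ)) : ℂ) •
                  UnitAddTorus.mFourierCoeff (EuclideanSpace.complexify ∘ (u.1 : T3 → R3)) k)) ∂μ = 0)
    {ν : ℝ} {f : T3 → R3} (hf : Torus.IsSmooth f) {N : ℕ} {R : ℝ} {μ : Measure H3}
    (hP : IsProbabilityMeasure μ) (hL : ∀ᵐ u ∂μ, IsLevel N u) (hB : ∀ᵐ u ∂μ, ‖u‖ ≤ R)
    (hS : ∀ d : ℕ, IsPolyStationary ν f N d μ)
    {U : Set ℝ} (hU : IsOpen U) (hU0 : Set.Ici (0 : ℝ) ⊆ U) {h : ℝ → ℝ} (hh : ContDiffOn ℝ 1 h U) :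
    Integrable (fun u : H3 =>
        h (4 * Real.pi ^ 2 * ∑ k ∈ Torus.freqBall N, Torus.freqNormSq k *
              ‖UnitAddTorus.mFourierCoeff (EuclideanSpace.complexify ∘ (u.1 : T3 → R3)) k‖ ^ 2) *
            Torus.nsGeneratorPairing ν f u (Torus.fourierTruncate N (u.1 : T3 → R3)) +
          ‖u‖ ^ 2 * deriv h (4 * Real.pi ^ 2 * ∑ k ∈ Torus.freqBall N, Torus.freqNormSq k *
              ‖UnitAddTorus.mFourierCoeff (EuclideanSpace.complexify ∘ (u.1 : T3 → R3)) k‖ ^ 2) *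
            Torus.nsGeneratorPairing ν f u (Torus.realTrigPoly (Torus.freqBall N) fun k =>
              (((4 * Real.pi ^ 2 * Torus.freqNormSq k : ℝ)) : ℂ) •
                UnitAddTorus.mFourierCoeff (EuclideanSpace.complexify ∘ (u.1 : T3 → R3)) k)) μ ∧
      ∫ u, (h (4 * Real.pi ^ 2 * ∑ k ∈ Torus.freqBall N, Torus.freqNormSq k *
              ‖UnitAddTorus.mFourierCoeff (EuclideanSpace.complexify ∘ (u.1 : T3 → R3)) k‖ ^ 2) *
            Torus.nsGeneratorPairing ν f u (Torus.fourierTruncate N (u.1 : T3 → R3)) +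
          ‖u‖ ^ 2 * deriv h (4 * Real.pi ^ 2 * ∑ k ∈ Torus.freqBall N, Torus.freqNormSq k *
              ‖UnitAddTorus.mFourierCoeff (EuclideanSpace.complexify ∘ (u.1 : T3 → R3)) k‖ ^ 2) *
            Torus.nsGeneratorPairing ν f u (Torus.realTrigPoly (Torus.freqBall N) fun k =>
              (((4 * Real.pi ^ 2 * Torus.freqNormSq k : ℝ)) : ℂ) •
                UnitAddTorus.mFourierCoeff (EuclideanSpace.complexify ∘ (u.1 : T3 → R3)) k)) ∂μ = 0 := by
  -- the ledger profile `Ψ(e,z) = ½ e h(z)` on `ℝ × U`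
  have hU' : IsOpen ((Set.univ : Set ℝ) ×ˢ U) := isOpen_univ.prod hU
  have hsub : Set.Ici (0 : ℝ) ×ˢ Set.Ici (0 : ℝ) ⊆ (Set.univ : Set ℝ) ×ˢ U := by
    rintro ⟨a, b⟩ ⟨-, hb⟩
    exact ⟨Set.mem_univ _, hU0 hb⟩
  have hΨ : ContDiffOn ℝ 1 (fun p : ℝ × ℝ => 2⁻¹ * p.1 * h p.2) ((Set.univ : Set ℝ) ×ˢ U) := by
    have h1 : ContDiffOn ℝ 1 (fun p : ℝ × ℝ => 2⁻¹ * p.1) ((Set.univ : Set ℝ) ×ˢ U) :=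
      (contDiff_const.mul contDiff_fst).contDiffOn
    have h2 : ContDiffOn ℝ 1 (fun p : ℝ × ℝ => h p.2) ((Set.univ : Set ℝ) ×ˢ U) :=
      hh.comp contDiff_snd.contDiffOn fun p hp => hp.2
    exact h1.mul h2
  obtain ⟨hI, h0⟩ := hRow ν f hf N R μ hP hL hB hS _ _ hU' hsub hΨ
  -- band enstrophy is nonnegative, hence in `U`, where `h` is differentiable
  have hnn : ∀ u : H3, (0 : ℝ) ≤ 4 * Real.pi ^ 2 * ∑ k ∈ Torus.freqBall N, Torus.freqNormSq k *
      ‖UnitAddTorus.mFourierCoeff (EuclideanSpace.complexify ∘ (u.1 : T3 → R3)) k‖ ^ 2 := fun u =>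
    mul_nonneg (by positivity) (Finset.sum_nonneg fun k _ =>
      mul_nonneg (Torus.freqNormSq_nonneg _) (sq_nonneg _))
  have hdiff : ∀ u : H3, DifferentiableAt ℝ h (4 * Real.pi ^ 2 * ∑ k ∈ Torus.freqBall N, Torus.freqNormSq k *
      ‖UnitAddTorus.mFourierCoeff (EuclideanSpace.complexify ∘ (u.1 : T3 → R3)) k‖ ^ 2) := fun u =>
    (hh.differentiableOn one_ne_zero).differentiableAt (hU.mem_nhds (hU0 (hnn u)))
  have hpt : ∀ u : H3,
      2 * fderiv ℝ (fun p : ℝ × ℝ => 2⁻¹ * p.1 * h p.2)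
            (‖u‖ ^ 2, 4 * Real.pi ^ 2 * ∑ k ∈ Torus.freqBall N, Torus.freqNormSq k *
              ‖UnitAddTorus.mFourierCoeff (EuclideanSpace.complexify ∘ (u.1 : T3 → R3)) k‖ ^ 2) (1, 0) *
            Torus.nsGeneratorPairing ν f u (Torus.fourierTruncate N (u.1 : T3 → R3)) +
          2 * fderiv ℝ (fun p : ℝ × ℝ => 2⁻¹ * p.1 * h p.2)
            (‖u‖ ^ 2, 4 * Real.pi ^ 2 * ∑ k ∈ Torus.freqBall N, Torus.freqNormSq k *
              ‖UnitAddTorus.mFourierCoeff (EuclideanSpace.complexify ∘ (u.1 : T3 → R3)) k‖ ^ 2) (0, 1) *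
            Torus.nsGeneratorPairing ν f u (Torus.realTrigPoly (Torus.freqBall N) fun k =>
              (((4 * Real.pi ^ 2 * Torus.freqNormSq k : ℝ)) : ℂ) •
                UnitAddTorus.mFourierCoeff (EuclideanSpace.complexify ∘ (u.1 : T3 → R3)) k) =
      h (4 * Real.pi ^ 2 * ∑ k ∈ Torus.freqBall N, Torus.freqNormSq k *
              ‖UnitAddTorus.mFourierCoeff (EuclideanSpace.complexify ∘ (u.1 : T3 → R3)) k‖ ^ 2) *
            Torus.nsGeneratorPairing ν f u (Torus.fourierTruncate N (u.1 : T3 → R3)) +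
          ‖u‖ ^ 2 * deriv h (4 * Real.pi ^ 2 * ∑ k ∈ Torus.freqBall N, Torus.freqNormSq k *
              ‖UnitAddTorus.mFourierCoeff (EuclideanSpace.complexify ∘ (u.1 : T3 → R3)) k‖ ^ 2) *
            Torus.nsGeneratorPairing ν f u (Torus.realTrigPoly (Torus.freqBall N) fun k =>
              (((4 * Real.pi ^ 2 * Torus.freqNormSq k : ℝ)) : ℂ) •
                UnitAddTorus.mFourierCoeff (EuclideanSpace.complexify ∘ (u.1 : T3 → R3)) k) := by
    intro u
    obtain ⟨h1, h2⟩ := fderiv_ledgerProfile (e := ‖u‖ ^ 2) (hdiff u)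
    rw [h1, h2]
    ring
  refine ⟨hI.congr (ae_of_all _ fun u => hpt u), ?_⟩
  rw [← integral_congr_ae (ae_of_all _ fun u => hpt u)]
  exact h0

/-- **THE LEVEL LEDGER (unconditional).** Every admissible law `μ` at `(ν, f, N, R)` (probability, level-`N` carried,
supported in `‖u‖ ≤ R`, stationary for Galerkin NS against all polynomial cylindrical band-limited observables) and every
`h : ℝ → ℝ` that is `C¹` on an open set containing `[0,∞)` satisfy
`∫ [ h(Z_N u) ⟨F(u), P_N u⟩ + ‖u‖² h'(Z_N u) ⟨F(u), A P_N u⟩ ] dμ = 0` (integrable row, zero mean) — the energy flux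
through enstrophy levels balances the viscous/injection budget above the level (`⟨F(u), P_N u⟩ = (u,f) − ν‖∇u‖²` on
level-`N` fields, `nsGeneratorPairing_fourierTruncate_of_isLevel`). First identity of attack U2 on the hard stub.
[folklore; FMRT2001 Ch. IV §1.2] -/
theorem levelLedger :
    ∀ (ν : ℝ) (f : T3 → R3), Torus.IsSmooth f → ∀ (N : ℕ) (R : ℝ) (μ : Measure H3), IsProbabilityMeasure μ →
      (∀ᵐ u ∂μ, IsLevel N u) → (∀ᵐ u ∂μ, ‖u‖ ≤ R) → (∀ d : ℕ, IsPolyStationary ν f N d μ) →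
    ∀ (U : Set ℝ) (h : ℝ → ℝ), IsOpen U → Set.Ici (0 : ℝ) ⊆ U → ContDiffOn ℝ 1 h U →
    Integrable (fun u : H3 =>
        h (4 * Real.pi ^ 2 * ∑ k ∈ Torus.freqBall N, Torus.freqNormSq k *
              ‖UnitAddTorus.mFourierCoeff (EuclideanSpace.complexify ∘ (u.1 : T3 → R3)) k‖ ^ 2) *
            Torus.nsGeneratorPairing ν f u (Torus.fourierTruncate N (u.1 : T3 → R3)) +
          ‖u‖ ^ 2 * deriv h (4 * Real.pi ^ 2 * ∑ k ∈ Torus.freqBall N, Torus.freqNormSq k *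
              ‖UnitAddTorus.mFourierCoeff (EuclideanSpace.complexify ∘ (u.1 : T3 → R3)) k‖ ^ 2) *
            Torus.nsGeneratorPairing ν f u (Torus.realTrigPoly (Torus.freqBall N) fun k =>
              (((4 * Real.pi ^ 2 * Torus.freqNormSq k : ℝ)) : ℂ) •
                UnitAddTorus.mFourierCoeff (EuclideanSpace.complexify ∘ (u.1 : T3 → R3)) k)) μ ∧
      ∫ u, (h (4 * Real.pi ^ 2 * ∑ k ∈ Torus.freqBall N, Torus.freqNormSq k *
              ‖UnitAddTorus.mFourierCoeff (EuclideanSpace.complexify ∘ (u.1 : T3 → R3)) k‖ ^ 2) *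
            Torus.nsGeneratorPairing ν f u (Torus.fourierTruncate N (u.1 : T3 → R3)) +
          ‖u‖ ^ 2 * deriv h (4 * Real.pi ^ 2 * ∑ k ∈ Torus.freqBall N, Torus.freqNormSq k *
              ‖UnitAddTorus.mFourierCoeff (EuclideanSpace.complexify ∘ (u.1 : T3 → R3)) k‖ ^ 2) *
            Torus.nsGeneratorPairing ν f u (Torus.realTrigPoly (Torus.freqBall N) fun k =>
              (((4 * Real.pi ^ 2 * Torus.freqNormSq k : ℝ)) : ℂ) •
                UnitAddTorus.mFourierCoeff (EuclideanSpace.complexify ∘ (u.1 : T3 → R3)) k)) ∂μ = 0 :=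
  fun _ν _f hf _N _R _μ hP hL hB hS _U _h hU hU0 hh =>
    levelLedger_of_smoothCylRow CylRow.stub_smoothCylRow hf hP hL hB hS hU hU0 hh

/-- **The energy-test row of a level-`N` state**: `⟨F(u), P_N u⟩ = (u, f) − ν‖∇u‖²` — the transport term
`b(u,u,P_N u)` vanishes on level-`N` fields (`CubicParityLoud.Negative.inertialPairing_fourierTruncate_of_isLevel`).
[folklore] -/
theorem nsGeneratorPairing_fourierTruncate_of_isLevel (ν : ℝ) (f : T3 → R3) {N : ℕ} {u : H3}
    (hu : IsLevel N u) :
    Torus.nsGeneratorPairing ν f u (Torus.fourierTruncate N (u.1 : T3 → R3)) =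
      Torus.pairing u.1 f - ν * (Torus.eGradNormSq (u.1 : T3 → R3)).toReal := by
  have h := Torus.nsGeneratorPairing_smul_fourierTruncate ν f u 1 N
  simp only [one_smul, one_mul] at h
  rw [show (fun x => Torus.fourierTruncate N (u.1 : T3 → R3) x) = Torus.fourierTruncate N (u.1 : T3 → R3)
    from rfl] at h
  rw [h, Summit.AnomalousDissipation.AnomalousDissipation.Theorems.CubicParityLoud.Negative.integral_inner_fourierTruncate_of_isLevel hu,
    Summit.AnomalousDissipation.AnomalousDissipation.Theorems.CubicParityLoud.Negative.eGradNormSq_fourierTruncate_of_isLevel hu,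
    Summit.AnomalousDissipation.AnomalousDissipation.Theorems.CubicParityLoud.Negative.inertialPairing_fourierTruncate_of_isLevel hu,
    add_zero]

end Summit.AnomalousDissipation.AnomalousDissipation.Theorems.MomentParityResolvedDissipation

end
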